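import Mathlib
import HarnessLib
import Literature.Analysis.FluidPDE.SelfSimilar
import Literature.Analysis.FluidPDE.VectorCalculus
import Literature.Analysis.FluidPDE.ClassicalSolution
import Summits.NavierStokesRegularity.NavierStokesRegularity.Theses.ThreadingFlux
import Summits.NavierStokesRegularity.NavierStokesRegularity.Theses.UnthreadedDoor
import Summits.NavierStokesRegularity.NavierStokesRegularity.Theorems.UnthreadedDoorAntidynamoCompositionModuloWall
import Summits.NavierStokesRegularity.NavierStokesRegularity.Theorems.UnthreadedDoorAntidynamoRadialGradientUnthreaded

/-!
# Route `UnthreadedDoor` / `ThreadingFlux`, crux `PoloidalLiouville` (stmt-NavierStokesRegularity-1222), antidynamo v2 skeleton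
# (sha16 `4ebf5683127b`), rung `stub_singleDegreeRung` (BC5), file 2/2: THE RUNG IS A SUB-CASE OF THE CRUX —
# `PoloidalLiouville → StubSingleDegreeRung` and `StubScalarLiouville → StubSingleDegreeRung`

Support file (seat leafhand-ns-unthreadeddoor-1 g0, cell decomp-ns), `--supports stmt-NavierStokesRegularity-1222 --as helper`.

The registered rung `StubSingleDegreeRung` (skeleton l. 152; twinned VERBATIM below) asks that a bounded ancient duality-class solution with
measurable slices, jointly smooth on `(−∞,0) × ℝ³`, each of whose slices has the single-degree form
`v t x = gradient φ x + (g ‖x − x₀‖ · P(x − x₀)) • (x − x₀)` — for SOME `g : ℝ → ℝ`, `φ : ℝ³ → ℝ`, NO regularity assumed, Mathlib's junk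
`gradient` — have constant slices.  By the junk-robust kinematic lemma of file 1/2 (`inner_curl_eq_zero_of_eq_gradient_add_smul_sub`:
a `C¹` field that is pointwise a junk gradient plus ANY scalar multiple of `x − x₀` has vorticity tangent to the spheres about `x₀`) every
such slice family is UNTHREADED about `x₀`, so the rung follows from the crux `PoloidalLiouville` BY NAME, for both token-identical route
decls, and hence from the wall `StubScalarLiouville` through the landed composition `poloidalLiouville_of_stubScalarLiouville` (p793469).
The polynomial structure (`P` a solid harmonic of degree `l ≥ 2`) is not used: the rung is the crux restricted to a sub-class.

* `StubSingleDegreeRung` — twin VERBATIM of the skeleton's stub Prop (l. 152).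
* ★ `singleDegree_unthreaded` — single-degree slice families (rung hypotheses, no regularity) are unthreaded about `x₀`.
* ★★ `stubSingleDegreeRung_of_poloidalLiouville` / `…'` — `PoloidalLiouville → StubSingleDegreeRung` (routes `ThreadingFlux` / `UnthreadedDoor`).
* ★★ `stubSingleDegreeRung_of_stubScalarLiouville` — `StubScalarLiouville → StubSingleDegreeRung`.

HONEST LABEL: structural; the rung itself is NOT closed unconditionally (it now sits exactly under the wall `stub_scalarLiouville`, XL,
open in print beyond axisymmetry); nothing here proves `PoloidalLiouville` (1222) or bears on NS regularity.  [folklore]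
-/

noncomputable section

-- the summit and its single sub-problem share the name (CONVENTIONS §1)
set_option linter.dupNamespace false

open scoped Topology InnerProductSpace RealInnerProductSpace ContDiff
open Filter Set Function Metric MeasureTheory
open Literature.Analysis.FluidPDE

namespace Summit.NavierStokesRegularity.NavierStokesRegularity.Theorems.PoloidalLiouville.Antidynamo

/-! ## §6 The rung `stub_singleDegreeRung` is a sub-case of the crux -/

/-- STUB 0 statement of the antidynamo v2 skeleton (planner ns-idea-6 g5) — twin, body VERBATIM (skeleton l. 152): the BC5 plan-only
rung, single-degree toroidal potentials.  A bounded ancient mild solution with measurable slices, jointly smooth on `(−∞,0) × ℝ³`, whose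
every slice has the single-degree form `v t x = gradient φ x + (g ‖x − x₀‖ · P(x − x₀)) • (x − x₀)` for a solid harmonic `P` of degree
`l ≥ 2`, has constant slices. -/
def StubSingleDegreeRung : Prop :=
  ∀ (v : ℝ → EuclideanSpace ℝ (Fin 3) → EuclideanSpace ℝ (Fin 3)) (x₀ : EuclideanSpace ℝ (Fin 3)),
    Literature.Analysis.FluidPDE.IsBoundedAncientMildSolution 1 v →
    (∀ t < 0, AEStronglyMeasurable (v t) volume) →
    ContDiffOn ℝ (⊤ : ℕ∞) (Function.uncurry v) (Set.Iio 0 ×ˢ Set.univ) →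
    (∃ (l : ℕ) (P : MvPolynomial (Fin 3) ℝ), 2 ≤ l ∧ P.IsHomogeneous l ∧
      (∀ y : EuclideanSpace ℝ (Fin 3),
        Laplacian.laplacian (fun z : EuclideanSpace ℝ (Fin 3) => MvPolynomial.eval (fun i => z i) P) y = 0) ∧
      ∀ t < 0, ∃ (g : ℝ → ℝ) (φ : EuclideanSpace ℝ (Fin 3) → ℝ), ∀ x,
        v t x = gradient φ x + (g ‖x - x₀‖ * MvPolynomial.eval (fun i => (x - x₀) i) P) • (x - x₀)) →
    ∀ t < 0, ∃ b : EuclideanSpace ℝ (Fin 3), ∀ x, v t x = b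

/-- ★ SINGLE-DEGREE SLICES ARE UNTHREADED (junk-robust): under the representation hypothesis of the rung — at each `t < 0`,
`v t x = gradient φ x + (g ‖x − x₀‖ · P(x − x₀)) • (x − x₀)` for SOME `g : ℝ → ℝ`, `φ : ℝ³ → ℝ`, no regularity assumed — and joint
smoothness of `v`, the vorticity is tangent to the spheres about `x₀`: `⟪x − x₀, curl v(t) x⟫ = 0` for all `t < 0`, `x`.  (The
polynomial structure of the coefficient is irrelevant: any scalar multiple of `x − x₀` will do.) [folklore] -/
theorem singleDegree_unthreaded
    (v : ℝ → EuclideanSpace ℝ (Fin 3) → EuclideanSpace ℝ (Fin 3)) (x₀ : EuclideanSpace ℝ (Fin 3))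
    (hsm : ContDiffOn ℝ (⊤ : ℕ∞) (Function.uncurry v) (Set.Iio 0 ×ˢ Set.univ))
    (P : MvPolynomial (Fin 3) ℝ)
    (hrep : ∀ t < 0, ∃ (g : ℝ → ℝ) (φ : EuclideanSpace ℝ (Fin 3) → ℝ), ∀ x,
        v t x = gradient φ x + (g ‖x - x₀‖ * MvPolynomial.eval (fun i => (x - x₀) i) P) • (x - x₀)) :
    ∀ t < 0, ∀ x, ⟪x - x₀, curl (v t) x⟫ = 0 := by
  intro t ht x
  have hsm' : IsSmoothSpaceTimeOn (Iio 0) v := hsm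
  have h1 : ContDiff ℝ 1 (v t) := (hsm'.contDiff_slice ht).of_le (by norm_cast)
  obtain ⟨g, φ, hφ⟩ := hrep t ht
  exact inner_curl_eq_zero_of_eq_gradient_add_smul_sub
    (h := fun x => g ‖x - x₀‖ * MvPolynomial.eval (fun i => (x - x₀) i) P) x₀ h1 hφ x

/-- ★★ THE RUNG IS A SUB-CASE OF THE CRUX: `PoloidalLiouville → StubSingleDegreeRung` (route `ThreadingFlux` decl).  A single-degree
slice family is unthreaded about `x₀` (`singleDegree_unthreaded`), so the crux applies verbatim. [folklore] -/
theorem stubSingleDegreeRung_of_poloidalLiouville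
    (hP : Summit.NavierStokesRegularity.NavierStokesRegularity.Theses.ThreadingFlux.PoloidalLiouville) :
    StubSingleDegreeRung := by
  intro v x₀ hB hm hsm hform
  obtain ⟨l, P, -, -, -, hrep⟩ := hform
  exact hP v hB hm hsm ⟨x₀, singleDegree_unthreaded v x₀ hsm P hrep⟩

/-- ★★ The same for the token-identical crux decl of route `UnthreadedDoor`: `PoloidalLiouville → StubSingleDegreeRung`. [folklore] -/
theorem stubSingleDegreeRung_of_poloidalLiouville'
    (hP : Summit.NavierStokesRegularity.NavierStokesRegularity.Theses.UnthreadedDoor.PoloidalLiouville) :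
    StubSingleDegreeRung :=
  stubSingleDegreeRung_of_poloidalLiouville hP

/-- ★★ Hence the rung is closed modulo the wall as well: `StubScalarLiouville → StubSingleDegreeRung` (antidynamo composition
`poloidalLiouville_of_stubScalarLiouville`). [folklore] -/
theorem stubSingleDegreeRung_of_stubScalarLiouville (hW : StubScalarLiouville) : StubSingleDegreeRung :=
  stubSingleDegreeRung_of_poloidalLiouville (poloidalLiouville_of_stubScalarLiouville hW)

end Summit.NavierStokesRegularity.NavierStokesRegularity.Theorems.PoloidalLiouville.Antidynamo

end
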